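import Literature.Analysis.Complex.BranchedCoveringCharPoly
import Literature.Analysis.Complex.PolynomialGrowthLiouvilleSCV
import Literature.Analysis.Complex.RiemannExtension
import HarnessLib

/-!
# The characteristic polynomial of a function along a finite branched covering of `ℂⁿ`

Layer `Literature/Analysis/Complex`. The several-variable version of
`Literature/Analysis/Complex/BranchedCoveringCharPoly.lean` (there: coverings of the line), i.e. the
classical device by which a holomorphic function of polynomial growth on a finite analytic covering of
affine space is seen to be algebraic (Serre, GAGA n° 19, Lemme 8 / n° 20; SGA 1 XII Thm. 5.1, proof,
part 2; Grauert–Remmert, *Coherent Analytic Sheaves*, §7.3 for the symmetric functions along an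
analytic covering): let `F : T → ℂ^ι` (`ι` finite) be a PROPER map with finite fibres from a
Hausdorff space, a local homeomorphism at every point over the complement of the algebraic
hypersurface `Δ = {δ = 0}` (`δ ≠ 0` a polynomial) through local inverses along which the
continuous function `h : T → ℂ` is holomorphic, with `T ∖ F⁻¹(Δ)` dense in `T` and
`|h| ≤ C₀ (1 + |F|)^K`. Then there is a MONIC polynomial `R ∈ ℂ[z_i : i ∈ ι][τ]` with
`R(F(t))(h(t)) = 0` for every `t ∈ T` (`exists_charPoly`).

Proof, as in one variable with the several-variable tools of the tree: the coefficients `σ_k(z)` of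
`∏_{F(t)=z} (τ - h(t))` are holomorphic on `ℂ^ι ∖ Δ` (local simultaneous sections,
`exists_nhds_fibre_eq_image`), locally bounded near `Δ` (properness) hence extend to entire functions
(Riemann's extension theorem across the thin set `Δ`,
`Literature.Analysis.Complex.SCV.exists_differentiableOn_eqOn_of_thin`), of polynomial growth, hence
POLYNOMIALS (`Literature.Analysis.Complex.exists_mvPolynomial_of_growth`, Liouville in `ℂ^ι`); the
fibre cardinality is constant off `Δ` because `ℂ^ι ∖ Δ` is connected
(`isPreconnected_setOf_eval_ne_zero`: two points of it are joined by a complex line meeting `Δ` in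
finitely many points), so `R = ∑ σ_k τ^k` is monic, and `R(F, h) = 0` off `F⁻¹(Δ)` hence everywhere
by density and continuity.

Also recorded: `differentiable_eval` (polynomial functions on `ℂ^ι` are holomorphic),
`eq_zero_of_eventuallyEq_zero` / `dense_setOf_eval_ne_zero` (a polynomial vanishing near a point is
zero; the complement of a proper algebraic hypersurface is dense), `differentiableOn_coeff_prod_X_sub_C`
(coefficients of `∏ (τ - a_i(z))` are holomorphic in `z ∈ E`).

Everything is proved; there are no definitions and no named facts.

## References

* J.-P. Serre, *Géométrie algébrique et géométrie analytique*, Ann. Inst. Fourier 6 (1956), n° 19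
  Lemme 8, n° 20. [SerreGAGA1956]
* A. Grothendieck, M. Raynaud, *SGA 1*, LNM 224 / arXiv:math/0206203, Exp. XII Thm. 5.1, proof,
  part 2. [SGA1]
* O. Forster, *Lectures on Riemann Surfaces*, GTM 81 (1981), §8 Thm. 8.2–8.3 (one variable).
  [Forster1981]

#harness_tags complex_analysis.several_variables, complex_geometry.riemann_existence, algebraic_geometry.sga1
-/

noncomputable section

open scoped Topology Polynomial
open Set Filter Function Polynomial Metric

namespace Literature.Analysis.Complex

namespace BranchedCoveringSCV

variable {T : Type*} [TopologicalSpace T] {B : Type*} [TopologicalSpace B]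

/-! ### Local simultaneous sections of a proper local homeomorphism (any base) -/

/-- There are open partial homeomorphisms `T ⇀ B` (the empty one) as soon as `T` and `B` have
points. [folklore] -/
theorem nonempty_openPartialHomeomorph (t₀ : T) (b₀ : B) : Nonempty (OpenPartialHomeomorph T B) :=
  ⟨{ toFun := fun _ ↦ b₀, invFun := fun _ ↦ t₀, source := ∅, target := ∅,
     map_source' := fun _ h ↦ h.elim, map_target' := fun _ h ↦ h.elim,
     left_inv' := fun _ h ↦ h.elim, right_inv' := fun _ h ↦ h.elim,
     open_source := isOpen_empty, open_target := isOpen_empty,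
     continuousOn_toFun := continuousOn_empty _, continuousOn_invFun := continuousOn_empty _ }⟩

/-- **Local simultaneous sections** (Forster, Lemma 4.21 / Thm. 4.22, for any base): let
`F : T → B` be proper, `Φ` the (finite) fibre over `z`, and `e_t` (`t ∈ Φ`) local homeomorphisms
agreeing with `F` and defined at `t`. Then on an open neighbourhood `V` of `z` contained in all the
targets, the fibre of `F` over `z' ∈ V` is exactly `{e_t⁻¹(z') : t ∈ Φ}`, without repetitions.
[cite: Forster1981, §4 Lemma 4.21, Thm. 4.22; §8.1] -/
theorem exists_nhds_fibre_eq_image [T2Space T] {F : T → B} (hprop : IsProperMap F) {z : B}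
    (Φ : Finset T) (hΦ : ∀ t, t ∈ Φ ↔ F t = z) (e : T → OpenPartialHomeomorph T B)
    (he : ∀ t ∈ Φ, t ∈ (e t).source ∧ ⇑(e t) = F) :
    ∃ V : Set B, IsOpen V ∧ z ∈ V ∧ (∀ t ∈ Φ, V ⊆ (e t).target) ∧
      ∀ z' ∈ V, Set.InjOn (fun t ↦ (e t).symm z') ↑Φ ∧
        F ⁻¹' {z'} = (fun t ↦ (e t).symm z') '' ↑Φ := by
  classical
  obtain ⟨W, hW, hdisj⟩ := Φ.finite_toSet.t2_separation
  -- the sheets and their union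
  set S : Set T := ⋃ t ∈ Φ, ((e t).source ∩ W t) with hS
  have hSopen : IsOpen S := isOpen_biUnion fun t _ ↦ (e t).open_source.inter (hW t).2
  have hKclosed : IsClosed (F '' Sᶜ) := hprop.isClosedMap _ hSopen.isClosed_compl
  have hzK : z ∉ F '' Sᶜ := by
    rintro ⟨t', ht'S, ht'z⟩
    apply ht'S
    have ht'Φ : t' ∈ Φ := (hΦ t').2 ht'z
    exact mem_biUnion (show t' ∈ (↑Φ : Set T) from ht'Φ) ⟨(he t' ht'Φ).1, (hW t').1⟩
  set V : Set B := (F '' Sᶜ)ᶜ ∩ ⋂ t ∈ Φ, ((e t).target ∩ (e t).symm ⁻¹' W t) with hV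
  refine ⟨V, ?_, ?_, ?_, ?_⟩
  · exact hKclosed.isOpen_compl.inter
      (isOpen_biInter_finset fun t _ ↦ (e t).isOpen_inter_preimage_symm (hW t).2)
  · refine ⟨hzK, mem_iInter₂.2 fun t ht ↦ ?_⟩
    have hzt : z = (e t) t := by rw [(he t ht).2]; exact ((hΦ t).1 ht).symm
    refine ⟨?_, ?_⟩
    · rw [hzt]; exact (e t).map_source (he t ht).1
    · show (e t).symm z ∈ W t
      rw [hzt, (e t).left_inv (he t ht).1]
      exact (hW t).1
  · intro t ht z' hz'
    exact ((mem_iInter₂.1 hz'.2) t ht).1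
  · intro z' hz'
    have hsec : ∀ t ∈ Φ, (e t).symm z' ∈ (e t).source ∩ W t := fun t ht ↦
      ⟨(e t).map_target ((mem_iInter₂.1 hz'.2) t ht).1, ((mem_iInter₂.1 hz'.2) t ht).2⟩
    refine ⟨?_, ?_⟩
    · intro t₁ h₁ t₂ h₂ heq
      by_contra hne
      have hd : Disjoint (W t₁) (W t₂) := hdisj h₁ h₂ hne
      have h1 : (e t₁).symm z' ∈ W t₁ := (hsec t₁ h₁).2
      have h2 : (e t₁).symm z' ∈ W t₂ := by
        have : (fun t ↦ (e t).symm z') t₁ = (fun t ↦ (e t).symm z') t₂ := heq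
        simp only at this
        rw [this]
        exact (hsec t₂ h₂).2
      exact Set.disjoint_left.1 hd h1 h2
    · ext t'
      refine ⟨fun ht' ↦ ?_, ?_⟩
      · have ht'z : F t' = z' := ht'
        have ht'S : t' ∈ S := by
          by_contra h
          exact hz'.1 ⟨t', h, ht'z⟩
        rw [hS, mem_iUnion₂] at ht'S
        obtain ⟨t, ht, hts, -⟩ := ht'S
        refine ⟨t, ht, ?_⟩
        show (e t).symm z' = t'
        rw [← ht'z, ← (he t ht).2, (e t).left_inv hts]
      · rintro ⟨t, ht, rfl⟩
        show F ((e t).symm z') = z'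
        rw [← (he t ht).2, (e t).right_inv ((mem_iInter₂.1 hz'.2) t ht).1]

/-! ### Coefficients of `∏ (τ - aᵢ(z))`, several variables -/

/-- The coefficients of `∏ᵢ (X - aᵢ(z))` depend holomorphically on holomorphic `aᵢ : E → ℂ`.
[folklore] -/
theorem differentiableOn_coeff_prod_X_sub_C {E : Type*} [NormedAddCommGroup E] [NormedSpace ℂ E]
    {ι : Type*} (s : Finset ι) {a : ι → E → ℂ} {V : Set E}
    (ha : ∀ i ∈ s, DifferentiableOn ℂ (a i) V) (k : ℕ) :
    DifferentiableOn ℂ (fun z ↦ (∏ i ∈ s, (X - C (a i z))).coeff k) V := by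
  classical
  induction s using Finset.induction_on generalizing k with
  | empty =>
    simp only [Finset.prod_empty, coeff_one]
    exact differentiableOn_const _
  | insert i s hi ih =>
    have ha' : ∀ j ∈ s, DifferentiableOn ℂ (a j) V := fun j hj ↦ ha j (Finset.mem_insert_of_mem hj)
    have hai : DifferentiableOn ℂ (a i) V := ha i (Finset.mem_insert_self i s)
    cases k with
    | zero =>
      have heq : ∀ z, (∏ j ∈ insert i s, (X - C (a j z))).coeff 0 =
          -(a i z * (∏ j ∈ s, (X - C (a j z))).coeff 0) := by
        intro z
        rw [Finset.prod_insert hi, sub_mul, coeff_sub, coeff_C_mul, coeff_X_mul_zero, zero_sub]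
      simp_rw [heq]
      exact (hai.mul (ih ha' 0)).neg
    | succ k =>
      have heq : ∀ z, (∏ j ∈ insert i s, (X - C (a j z))).coeff (k + 1) =
          (∏ j ∈ s, (X - C (a j z))).coeff k - a i z * (∏ j ∈ s, (X - C (a j z))).coeff (k + 1) := by
        intro z
        rw [Finset.prod_insert hi, sub_mul, coeff_sub, coeff_C_mul, coeff_X_mul]
      simp_rw [heq]
      exact (ih ha' k).sub (hai.mul (ih ha' (k + 1)))

/-! ### Polynomial functions on `ℂ^ι`: holomorphy, identity principle, the hypersurface complement -/

section PolynomialFunctions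

variable {ι : Type*} [Fintype ι]

/-- Polynomial functions `z ↦ δ(z)` on `ℂ^ι` are complex differentiable. [folklore] -/
theorem differentiable_eval (δ : MvPolynomial ι ℂ) :
    Differentiable ℂ fun z : ι → ℂ ↦ MvPolynomial.eval z δ := by
  induction δ using MvPolynomial.induction_on with
  | C a =>
    simp only [MvPolynomial.eval_C]
    exact differentiable_const a
  | add p q hp hq =>
    simp only [map_add]
    exact hp.add hq
  | mul_X p i hp =>
    simp only [map_mul, MvPolynomial.eval_X]
    exact hp.mul (differentiable_apply i)

omit [Fintype ι] in
/-- The restriction of a polynomial function on `ℂ^ι` to the complex line `s ↦ z + s (w - z)` is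
the evaluation of a one-variable polynomial. [folklore] -/
theorem exists_polynomial_eval_line (δ : MvPolynomial ι ℂ) (z w : ι → ℂ) :
    ∃ P : ℂ[X], ∀ s : ℂ, P.eval s = MvPolynomial.eval (z + s • (w - z)) δ := by
  refine ⟨MvPolynomial.aeval (fun i ↦ Polynomial.C (z i) + Polynomial.X * Polynomial.C (w i - z i)) δ,
    fun s ↦ ?_⟩
  rw [← Polynomial.coe_aeval_eq_eval, ← AlgHom.comp_apply, MvPolynomial.comp_aeval]
  show (MvPolynomial.aeval _ : MvPolynomial ι ℂ → ℂ) δ = _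
  rw [MvPolynomial.aeval_eq_eval]
  congr 2
  funext i
  simp

/-- **Identity principle for polynomials**: a polynomial on `ℂ^ι` vanishing on a neighbourhood of
one point is the zero polynomial (identity theorem for the entire function `δ` on the connected
space `ℂ^ι`, then `MvPolynomial.funext`). [folklore] -/
theorem eq_zero_of_eventuallyEq_zero {δ : MvPolynomial ι ℂ} {a : ι → ℂ}
    (h : (fun z : ι → ℂ ↦ MvPolynomial.eval z δ) =ᶠ[𝓝 a] 0) : δ = 0 := by
  have hall : EqOn (fun z : ι → ℂ ↦ MvPolynomial.eval z δ) 0 univ :=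
    SCV.eqOn_zero_of_preconnected_of_eventuallyEq_zero (differentiable_eval δ).differentiableOn
      isOpen_univ isPreconnected_univ (mem_univ a) h
  refine MvPolynomial.funext fun z ↦ ?_
  simpa using hall (mem_univ z)

/-- The complement of a proper algebraic hypersurface `{δ = 0}` (`δ ≠ 0`) is dense in `ℂ^ι`.
[folklore] -/
theorem dense_setOf_eval_ne_zero {δ : MvPolynomial ι ℂ} (hδ : δ ≠ 0) :
    Dense {z : ι → ℂ | MvPolynomial.eval z δ ≠ 0} := by
  intro a
  by_contra ha
  rw [mem_closure_iff_nhds, not_forall] at ha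
  obtain ⟨U, hU⟩ := ha
  rw [Classical.not_imp, not_nonempty_iff_eq_empty] at hU
  apply hδ
  refine eq_zero_of_eventuallyEq_zero (a := a) ?_
  filter_upwards [hU.1] with z hz
  by_contra hne
  have : z ∈ U ∩ {z : ι → ℂ | MvPolynomial.eval z δ ≠ 0} := ⟨hz, hne⟩
  rw [hU.2] at this
  exact this

omit [Fintype ι] in
/-- **The complement of an algebraic hypersurface in `ℂ^ι` is connected**: any two points `z, w`
with `δ(z), δ(w) ≠ 0` lie on the complex line `z + ℂ (w - z)`, which meets `{δ = 0}` in the finitely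
many roots of a non-zero one-variable polynomial, and the complement of a finite subset of `ℂ` is
connected. [folklore] -/
theorem isPreconnected_setOf_eval_ne_zero (δ : MvPolynomial ι ℂ) :
    IsPreconnected {z : ι → ℂ | MvPolynomial.eval z δ ≠ 0} := by
  refine isPreconnected_of_forall_pair fun z hz w hw ↦ ?_
  obtain ⟨P, hP⟩ := exists_polynomial_eval_line δ z w
  set ℓ : ℂ → ι → ℂ := fun s ↦ z + s • (w - z) with hℓ
  have hℓc : Continuous ℓ := by fun_prop
  have hP0 : P ≠ 0 := by
    intro h0
    apply hz
    have := hP 0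
    rw [h0, eval_zero, zero_smul, add_zero] at this
    exact this.symm
  have hfin : {s : ℂ | P.IsRoot s}.Finite := P.finite_setOf_isRoot hP0
  refine ⟨ℓ '' {s : ℂ | P.IsRoot s}ᶜ, ?_, ?_, ?_, ?_⟩
  · rintro _ ⟨s, hs, rfl⟩
    show MvPolynomial.eval (ℓ s) δ ≠ 0
    rw [hℓ]
    dsimp only
    rw [← hP s]
    exact hs
  · refine ⟨0, ?_, by simp [hℓ]⟩
    show ¬ P.IsRoot 0
    rw [IsRoot.def, hP 0, zero_smul, add_zero]
    exact hz
  · refine ⟨1, ?_, by simp [hℓ]⟩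
    show ¬ P.IsRoot 1
    rw [IsRoot.def, hP 1, one_smul, add_sub_cancel]
    exact hw
  · exact (BranchedCovering.isPreconnected_compl_of_finite hfin).image ℓ hℓc.continuousOn

end PolynomialFunctions

/-! ### The characteristic polynomial -/

/-- **The characteristic polynomial of a function along a finite branched covering of `ℂ^ι`**
(Serre, GAGA n° 19 Lemme 8 / SGA 1 XII 5.1, proof, part 2, affine polynomial-growth form). Let
`F : T → ℂ^ι` be proper with finite fibres on a Hausdorff space, a local homeomorphism at every point
over `{δ ≠ 0}` (`δ ≠ 0` a polynomial) through local inverses along which the continuous function `h`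
is holomorphic, with `{t | δ(F t) ≠ 0}` dense in `T` and `|h| ≤ C₀ (1 + |F|)^K`. Then there is a
monic `R ∈ ℂ[z][τ]` (`ℂ[z] = MvPolynomial ι ℂ`) with `R(F(t))(h(t)) = 0` for all `t`.
[cite: SerreGAGA1956, n° 19 Lemme 8] -/
theorem exists_charPoly {ι : Type*} [Fintype ι] [T2Space T] {F : T → ι → ℂ}
    (hprop : IsProperMap F) (hfin : ∀ z, (F ⁻¹' {z}).Finite) {δ : MvPolynomial ι ℂ} (hδ : δ ≠ 0)
    {h : T → ℂ} (hh : Continuous h)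
    (hloc : ∀ t, MvPolynomial.eval (F t) δ ≠ 0 → ∃ e : OpenPartialHomeomorph T (ι → ℂ),
      t ∈ e.source ∧ ⇑e = F ∧ DifferentiableOn ℂ (h ∘ e.symm) e.target)
    (hdense : Dense {t : T | MvPolynomial.eval (F t) δ ≠ 0})
    {C₀ : ℝ} {K : ℕ} (hgrowth : ∀ t, ‖h t‖ ≤ C₀ * (1 + ‖F t‖) ^ K) :
    ∃ R : Polynomial (MvPolynomial ι ℂ), R.Monic ∧
      ∀ t, (R.map (MvPolynomial.eval (F t))).eval (h t) = 0 := by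
  classical
  -- the empty case
  rcases isEmpty_or_nonempty T with hT | ⟨⟨t₀⟩⟩
  · exact ⟨X, monic_X, fun t ↦ (IsEmpty.false t).elim⟩
  have hF : Continuous F := hprop.continuous
  -- the hypersurface `Δ` and its complement `S`
  set ev : (ι → ℂ) → ℂ := fun z ↦ MvPolynomial.eval z δ with hev
  have hevc : Continuous ev := (differentiable_eval δ).continuous
  set Δ : Set (ι → ℂ) := {z | ev z = 0} with hΔ
  have hΔclosed : IsClosed Δ := isClosed_eq hevc continuous_const
  have hSopen : IsOpen Δᶜ := hΔclosed.isOpen_compl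
  have hS_eq : Δᶜ = {z | MvPolynomial.eval z δ ≠ 0} := rfl
  have hSdense : Dense Δᶜ := dense_setOf_eval_ne_zero hδ
  have hSconn : IsPreconnected Δᶜ := isPreconnected_setOf_eval_ne_zero δ
  -- a choice of local inverses
  set e : T → OpenPartialHomeomorph T (ι → ℂ) := fun t ↦
    if ht : MvPolynomial.eval (F t) δ ≠ 0 then (hloc t ht).choose
    else Classical.choice (nonempty_openPartialHomeomorph t₀ (0 : ι → ℂ)) with he_def
  have he : ∀ t, F t ∈ Δᶜ → t ∈ (e t).source ∧ ⇑(e t) = F ∧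
      DifferentiableOn ℂ (h ∘ (e t).symm) (e t).target := by
    intro t ht
    have ht' : MvPolynomial.eval (F t) δ ≠ 0 := ht
    have : e t = (hloc t ht').choose := by simp only [he_def, dif_pos ht']
    rw [this]
    exact (hloc t ht').choose_spec
  -- fibres, the fibrewise polynomial and its coefficients
  set fib : (ι → ℂ) → Finset T := fun z ↦ (hfin z).toFinset with hfib_def
  have hfib : ∀ z t, t ∈ fib z ↔ F t = z := fun z t ↦ by
    simp only [hfib_def, Finite.mem_toFinset, mem_preimage, mem_singleton_iff]
  set p : (ι → ℂ) → ℂ[X] := fun z ↦ ∏ t ∈ fib z, (X - C (h t)) with hp_def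
  set σ : ℕ → (ι → ℂ) → ℂ := fun k z ↦ (p z).coeff k with hσ_def
  have hp_monic : ∀ z, (p z).Monic := fun z ↦ monic_prod_X_sub_C _ _
  have hp_deg : ∀ z, (p z).natDegree = (fib z).card := fun z ↦ natDegree_finsetProd_X_sub_C_eq_card _ _
  -- local structure over a good value
  have hlocal : ∀ z, z ∈ Δᶜ → ∃ V : Set (ι → ℂ), IsOpen V ∧ z ∈ V ∧
      (∀ t ∈ fib z, DifferentiableOn ℂ (fun z' ↦ h ((e t).symm z')) V) ∧
      ∀ z' ∈ V, p z' = ∏ t ∈ fib z, (X - C (h ((e t).symm z'))) ∧ (fib z').card = (fib z).card := by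
    intro z hz
    have he' : ∀ t ∈ fib z, t ∈ (e t).source ∧ ⇑(e t) = F := fun t ht ↦
      ⟨(he t (by rwa [(hfib z t).1 ht])).1, (he t (by rwa [(hfib z t).1 ht])).2.1⟩
    obtain ⟨V, hVopen, hzV, hVsub, hV⟩ := exists_nhds_fibre_eq_image hprop (fib z) (hfib z) e he'
    refine ⟨V, hVopen, hzV, fun t ht ↦ ?_, fun z' hz' ↦ ?_⟩
    · exact ((he t (by rwa [(hfib z t).1 ht])).2.2).mono (hVsub t ht)
    · obtain ⟨hinj, hpre⟩ := hV z' hz'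
      have hfib' : fib z' = (fib z).image fun t ↦ (e t).symm z' := by
        ext t'
        rw [hfib, Finset.mem_image]
        have : t' ∈ F ⁻¹' {z'} ↔ t' ∈ (fun t ↦ (e t).symm z') '' ↑(fib z) := by rw [hpre]
        simpa only [mem_preimage, mem_singleton_iff, mem_image, Finset.mem_coe] using this
      refine ⟨?_, ?_⟩
      · simp only [hp_def, hfib']
        rw [Finset.prod_image hinj]
      · rw [hfib', Finset.card_image_of_injOn hinj]
  -- holomorphy of the coefficients off `Δ`
  have hσdiff : ∀ k, DifferentiableOn ℂ (σ k) Δᶜ := by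
    intro k z hz
    obtain ⟨V, hVopen, hzV, hdiffV, hV⟩ := hlocal z hz
    have h1 : DifferentiableOn ℂ (fun z' ↦ (∏ t ∈ fib z, (X - C (h ((e t).symm z')))).coeff k) V :=
      differentiableOn_coeff_prod_X_sub_C (fib z) (a := fun t z' ↦ h ((e t).symm z')) hdiffV k
    have h2 : DifferentiableAt ℂ (σ k) z := by
      refine ((h1 z hzV).differentiableAt (hVopen.mem_nhds hzV)).congr_of_eventuallyEq ?_
      filter_upwards [hVopen.mem_nhds hzV] with z' hz'
      simp only [hσ_def, (hV z' hz').1]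
    exact h2.differentiableWithinAt
  -- constancy of the fibre cardinality off `Δ`
  obtain ⟨z₀, hz₀⟩ := hSdense.nonempty
  set n : ℕ := (fib z₀).card with hn_def
  have hcard : ∀ z, z ∈ Δᶜ → (fib z).card = n := by
    intro z hz
    refine hSconn.constant (f := fun z ↦ (fib z).card) ?_ hz hz₀
    intro w hw
    obtain ⟨V, hVopen, hwV, -, hV⟩ := hlocal w hw
    have hc : ContinuousAt (fun z ↦ (fib z).card) w := by
      refine (continuousAt_const (y := (fib w).card)).congr_of_eventuallyEq ?_
      filter_upwards [hVopen.mem_nhds hwV] with z' hz'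
      exact (hV z' hz').2
    exact hc.continuousWithinAt
  -- the coefficient bound
  have hσbound : ∀ k z, ‖σ k z‖ ≤ ∏ t ∈ fib z, (1 + ‖h t‖) := fun k z ↦
    BranchedCovering.norm_coeff_prod_X_sub_C_le _ _ _
  have hprod_le : ∀ (z : ι → ℂ) (B : ℝ), 0 ≤ B → (∀ t ∈ fib z, ‖h t‖ ≤ B) →
      ∏ t ∈ fib z, (1 + ‖h t‖) ≤ (1 + B) ^ (fib z).card := by
    intro z B hB hle
    calc ∏ t ∈ fib z, (1 + ‖h t‖) ≤ ∏ _t ∈ fib z, (1 + B) :=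
          Finset.prod_le_prod (fun _ _ ↦ by positivity) fun t ht ↦ by linarith [hle t ht]
      _ = (1 + B) ^ (fib z).card := Finset.prod_const _
  -- local boundedness near the points of `Δ`
  have hσnear : ∀ k, ∀ c ∈ Δ ∩ univ, ∃ W ∈ 𝓝 c, ∃ Bd : ℝ, ∀ z ∈ W \ Δ, ‖σ k z‖ ≤ Bd := by
    intro k c _
    have hcpt : IsCompact (F ⁻¹' closedBall c 1) := hprop.isCompact_preimage (isCompact_closedBall c 1)
    obtain ⟨B₀, hB₀⟩ := hcpt.exists_bound_of_continuousOn hh.continuousOn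
    set Bd := max B₀ 0 with hBd
    refine ⟨ball c 1, ball_mem_nhds c one_pos, (1 + Bd) ^ n, fun z hz ↦ ?_⟩
    have hzS : z ∈ Δᶜ := hz.2
    calc ‖σ k z‖ ≤ ∏ t ∈ fib z, (1 + ‖h t‖) := hσbound k z
      _ ≤ (1 + Bd) ^ (fib z).card := hprod_le z Bd (le_max_right _ _) fun t ht ↦ by
          refine (hB₀ t ?_).trans (le_max_left _ _)
          rw [mem_preimage, (hfib z t).1 ht]
          exact ball_subset_closedBall hz.1
      _ = (1 + Bd) ^ n := by rw [hcard z hzS]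
  -- the global polynomial bound off `Δ`
  set C' : ℝ := max C₀ 0 with hC'
  have hσglobal : ∀ k z, z ∈ Δᶜ → ‖σ k z‖ ≤ (1 + C') ^ n * (1 + ‖z‖) ^ (K * n) := by
    intro k z hz
    have hle : ∀ t ∈ fib z, ‖h t‖ ≤ C' * (1 + ‖z‖) ^ K := fun t ht ↦ by
      rw [← (hfib z t).1 ht]
      exact (hgrowth t).trans (mul_le_mul_of_nonneg_right (le_max_left _ _) (by positivity))
    calc ‖σ k z‖ ≤ ∏ t ∈ fib z, (1 + ‖h t‖) := hσbound k z
      _ ≤ (1 + C' * (1 + ‖z‖) ^ K) ^ (fib z).card := hprod_le z _ (by positivity) hle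
      _ ≤ ((1 + C') * (1 + ‖z‖) ^ K) ^ (fib z).card := by
          gcongr
          have h1 : (1 : ℝ) ≤ (1 + ‖z‖) ^ K := one_le_pow₀ (by linarith [norm_nonneg z])
          nlinarith [le_max_right C₀ 0]
      _ = (1 + C') ^ n * (1 + ‖z‖) ^ (K * n) := by rw [hcard z hz, mul_pow, ← pow_mul]
  -- thinness of `Δ` in the sense of the Riemann extension theorem
  have hthin : ∀ a ∈ Δ ∩ univ, ∃ (φ : (ι → ℂ) → ℂ) (W : Set (ι → ℂ)), IsOpen W ∧ a ∈ W ∧ W ⊆ univ ∧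
      DifferentiableOn ℂ φ W ∧ (∀ x ∈ Δ ∩ W, φ x = 0) ∧ ¬ φ =ᶠ[𝓝 a] 0 := by
    intro a _
    refine ⟨ev, univ, isOpen_univ, mem_univ a, Subset.rfl, (differentiable_eval δ).differentiableOn,
      fun x hx ↦ hx.1, fun hzero ↦ hδ (eq_zero_of_eventuallyEq_zero hzero)⟩
  -- the entire extensions of the coefficients and their growth
  have hG : ∀ k, ∃ G : (ι → ℂ) → ℂ, Differentiable ℂ G ∧ EqOn G (σ k) Δᶜ ∧
      ∀ q, ‖G q‖ ≤ (1 + C') ^ n * (1 + ‖q‖) ^ (K * n) := by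
    intro k
    have hUA : IsOpen (univ \ Δ) := by rw [← compl_eq_univ_sdiff]; exact hSopen
    obtain ⟨G, hGd, hGeq⟩ := SCV.exists_differentiableOn_eqOn_of_thin (f := σ k) hUA hthin
      (by rw [← compl_eq_univ_sdiff]; exact hσdiff k) (hσnear k)
    rw [← compl_eq_univ_sdiff] at hGeq
    have hGd' : Differentiable ℂ G := differentiableOn_univ.1 hGd
    refine ⟨G, hGd', hGeq, ?_⟩
    -- the bound extends over `Δ` by continuity and density
    have hclosed : IsClosed {q : ι → ℂ | ‖G q‖ ≤ (1 + C') ^ n * (1 + ‖q‖) ^ (K * n)} :=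
      isClosed_le hGd'.continuous.norm (by fun_prop)
    have hsub : Δᶜ ⊆ {q : ι → ℂ | ‖G q‖ ≤ (1 + C') ^ n * (1 + ‖q‖) ^ (K * n)} := fun q hq ↦ by
      show ‖G q‖ ≤ _
      rw [hGeq hq]
      exact hσglobal k q hq
    intro q
    exact hclosed.closure_subset_iff.2 hsub (hSdense q)
  -- the coefficients are polynomials
  have hpoly : ∀ k, ∃ g : MvPolynomial ι ℂ, ∀ z, z ∈ Δᶜ → MvPolynomial.eval z g = σ k z := by
    intro k
    obtain ⟨G, hGd, hGeq, hGb⟩ := hG k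
    obtain ⟨g, -, hg⟩ := exists_mvPolynomial_of_growth hGd hGb
    exact ⟨g, fun z hz ↦ by rw [hg z, hGeq hz]⟩
  choose g hg using hpoly
  -- the characteristic polynomial
  set R : Polynomial (MvPolynomial ι ℂ) := ∑ k ∈ Finset.range (n + 1), C (g k) * X ^ k with hR
  have hRcoeff : ∀ k, R.coeff k = if k ∈ Finset.range (n + 1) then g k else 0 := by
    intro k
    simp only [hR, finsetSum_coeff, coeff_C_mul_X_pow]
    rw [Finset.sum_ite_eq]
  -- specialisation at a good value is the fibrewise polynomial
  have hRmap : ∀ z, z ∈ Δᶜ → R.map (MvPolynomial.eval z) = p z := by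
    intro z hz
    ext k
    rw [coeff_map, hRcoeff]
    split_ifs with hk
    · rw [hg k z hz]
    · rw [Finset.mem_range, not_lt] at hk
      rw [map_zero]
      symm
      apply coeff_eq_zero_of_natDegree_lt
      rw [hp_deg, hcard z hz]
      omega
  -- `R` is monic of degree `n`
  have hgn : g n = 1 := by
    apply MvPolynomial.funext
    intro z
    rw [map_one]
    -- `eval z (g n) = 1` on the dense set `Δᶜ`, hence everywhere
    have hclosed : IsClosed {z : ι → ℂ | MvPolynomial.eval z (g n) = 1} :=
      isClosed_eq (differentiable_eval (g n)).continuous continuous_const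
    refine hclosed.closure_subset_iff.2 (fun w hw ↦ ?_) (hSdense z)
    show MvPolynomial.eval w (g n) = 1
    rw [hg n w hw]
    show (p w).coeff n = 1
    have h := (hp_monic w).coeff_natDegree
    rwa [hp_deg, hcard w hw] at h
  have hRmonic : R.Monic := by
    refine monic_of_natDegree_le_of_coeff_eq_one n ?_ ?_
    · refine natDegree_sum_le_of_forall_le _ _ fun k hk ↦ ?_
      refine (natDegree_C_mul_X_pow_le _ _).trans ?_
      rw [Finset.mem_range] at hk
      omega
    · rw [hRcoeff, if_pos (Finset.self_mem_range_succ n), hgn]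
  refine ⟨R, hRmonic, ?_⟩
  -- the root property off `F⁻¹(Δ)` ...
  have hroot : ∀ t, F t ∈ Δᶜ → (R.map (MvPolynomial.eval (F t))).eval (h t) = 0 := by
    intro t ht
    rw [hRmap (F t) ht, hp_def]
    simp only [eval_prod, eval_sub, eval_X, eval_C]
    exact Finset.prod_eq_zero ((hfib (F t) t).2 rfl) (sub_self _)
  -- ... and everywhere, by density and continuity
  have hcont : Continuous fun t ↦ (R.map (MvPolynomial.eval (F t))).eval (h t) := by
    have heq : ∀ t, (R.map (MvPolynomial.eval (F t))).eval (h t) =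
        ∑ k ∈ Finset.range (n + 1), MvPolynomial.eval (F t) (g k) * h t ^ k := by
      intro t
      simp only [hR, Polynomial.map_sum, Polynomial.map_mul, map_C, Polynomial.map_pow, map_X,
        eval_finsetSum, eval_mul, eval_C, eval_pow, eval_X]
    simp_rw [heq]
    exact continuous_finsetSum _ fun k _ ↦
      (((differentiable_eval (g k)).continuous).comp hF).mul (hh.pow k)
  have hzero : (fun t ↦ (R.map (MvPolynomial.eval (F t))).eval (h t)) = fun _ ↦ 0 :=
    Continuous.ext_on hdense hcont continuous_const fun t ht ↦ hroot t ht
  exact fun t ↦ congr_fun hzero t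

end BranchedCoveringSCV

end Literature.Analysis.Complex
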